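import Summits.ValiantsHypothesis.ValiantsHypothesis.Theorems.LacunarySymmetroidMatrixDescartesCensusTropicalKLawSlopes

/-!
# Route «KPlusLogSqLaw», crux `TropicalB` (stmt-ValiantsHypothesis-19771) — the PROFILE-HYPERPLANE CEILING:
# one conserved linear class statistic costs a full power of `m + 1`; COCYCLE-GRADED designs have chains `< (m+1)^(K−2)`

HONEST FRAMING.  Helper (`--supports stmt-ValiantsHypothesis-19771 --as helper`, def-free) toward the registered stubs of
`Cruxes/TropicalB/Lines/birth.lean` (crux `Summit.ValiantsHypothesis.ValiantsHypothesis.Theses.KPlusLogSqLaw.TropicalB`, route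
KPlusLogSqLaw; hand leafhand-val-kpluslogsqlaw-1 g38, 2026-09-01).  A NO-GO (upper-bound) law for a class of CONSTRUCTIONS; it proves no
stub, decides nothing about the cell's `K = 4` fork (`TropK4Law 2`), and says nothing about `TropicalB` in its window, `WeakLifting`,
`Lifting`, `MatrixDescartes` or VP ≠ VNP.

THE LAW.  Along a sign-alternating dominant chain of an `(m, K)` design the slopes `Σ_l d_l·n_l` strictly increase
(`slope_lt_of_dominant`), so the CLASS PROFILES `n = (n_l)_l` (`n_l = #{i : λ i = l}`) of its terms are pairwise distinct; the tree's
slope-counting law (`tropRootLawAt_slopeCount`) bounds them by all of `{n : Σ n_l = m}`.  Here: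

* `sum_comp_eq_sum_mul_card` — bookkeeping `Σ_i w(λ i) = Σ_l w_l · n_l`;
* **`succ_le_pow_of_conserved`** — if some integer class statistic `Σ_i δ(λ_k i)` takes the SAME value on every term of the chain and
  `δ` separates two classes (`δ l₀ ≠ δ l₁`), the profiles lie on a hyperplane transverse to `Σ n_l = m`, the two coordinates
  `n_{l₀}, n_{l₁}` are determined by the other `K − 2`, and the chain has at most `(m+1)^(K−2)` terms — one conserved statistic costs
  a full factor `m + 1` against the profile count `(m+1)^(K−1)`;
* `sum_delta_eq_of_graded` — COCYCLE IDENTITY: if class `l` is PRESENT at entry `(r, c)` only when `φR r − φC c = δ l` (integer row /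
  column potentials: a GRADED or block-band design), then every present term `(σ, λ)` has `Σ_i δ(λ i) = Σ_r φR r − Σ_c φC c`
  (re-indexing by `σ`), a conserved statistic;
* **`succ_le_pow_of_graded`** — hence every dominant sign-alternating chain of a graded design whose grading separates two classes has
  at most `(m+1)^(K−2)` terms; **`chain_le_sq_of_graded_four`** — at `K = 4` graded designs obey `n + 1 ≤ (m+1)²`, i.e. the inequality
  of `TropK4Law 2` with constant `1`: no graded / block-band / single-offset architecture can witness a cubic `K = 4` column (the
  counting-tight `(m,3)` family SHIFT-THREE and the quadratic `(m,4)` family GRW-lite are NOT graded — they put two classes on one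
  entry — which is exactly how they escape).

[folklore: convexity of the upper envelope (tree: `slope_lt_of_dominant`) + the cocycle identity `Σ_c (φ(σ c) − φ(c)) = const` + counting
lattice points on a hyperplane section of the simplex; no citation exists for the cell's design vocabulary]
-/

set_option linter.dupNamespace false
set_option autoImplicit false

namespace Summit.ValiantsHypothesis.ValiantsHypothesis.Theorems.KPlusLogSqLaw

namespace ProfileHyperplane

open Summit.ValiantsHypothesis.ValiantsHypothesis.Theorems.LacunarySymmetroidMatrixDescartes.TropicalCensus
open Summit.ValiantsHypothesis.ValiantsHypothesis.Theorems.MatrixDescartes.Negative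
open scoped BigOperators
open Finset

variable {m K : ℕ}

/-! ## 1. Class statistics are linear in the profile -/

/-- `Σ_i w(λ i) = Σ_l w_l · #{i : λ i = l}`: a class statistic is a linear form in the class profile. [folklore] -/
theorem sum_comp_eq_sum_mul_card (w : Fin K → ℤ) (lam : Fin m → Fin K) :
    ∑ i, w (lam i) = ∑ l : Fin K, w l * ((univ.filter fun i : Fin m => lam i = l).card : ℤ) := by
  classical
  rw [← Finset.sum_fiberwise_of_maps_to (s := (univ : Finset (Fin m))) (t := (univ : Finset (Fin K))) (g := lam)
    (fun i _ => mem_univ (lam i)) (fun i => w (lam i))]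
  refine Finset.sum_congr rfl fun l _ => ?_
  have h : ∀ i ∈ univ.filter (fun i : Fin m => lam i = l), w (lam i) = w l := by
    intro i hi
    rw [(Finset.mem_filter.mp hi).2]
  rw [Finset.sum_congr rfl h, Finset.sum_const, nsmul_eq_mul, mul_comm]

/-- the slope of a term as a linear form in its profile: `slope d (σ, λ) = Σ_l d_l · #{i : λ i = l}`. [folklore] -/
theorem slope_eq_sum_mul_card (d : Fin K → ℕ) (p : Equiv.Perm (Fin m) × (Fin m → Fin K)) :
    LacunarySymmetroidMatrixDescartes.TropicalCensus.slope d p =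
      ∑ l : Fin K, (d l : ℤ) * ((univ.filter fun i : Fin m => p.2 i = l).card : ℤ) := by
  unfold LacunarySymmetroidMatrixDescartes.TropicalCensus.slope
  exact sum_comp_eq_sum_mul_card (fun l => (d l : ℤ)) p.2

/-- a sum over `Fin K` whose terms vanish off `{l₀, l₁}` is the sum of those two terms. [folklore] -/
theorem sum_eq_two {l₀ l₁ : Fin K} (hl : l₀ ≠ l₁) (f : Fin K → ℤ) (hf : ∀ l, l ≠ l₀ → l ≠ l₁ → f l = 0) :
    ∑ l, f l = f l₀ + f l₁ := by
  rw [Finset.sum_eq_add l₀ l₁ hl (fun l _ h => hf l h.1 h.2) (fun h => absurd (mem_univ _) h)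
    (fun h => absurd (mem_univ _) h)]

/-! ## 2. The profile-hyperplane ceiling -/

/-- **PROFILE-HYPERPLANE CEILING.**  If an integer class statistic `Σ_i δ(λ_k i)` is constant along a dominant sign-alternating chain
of an `(m, K)` design and `δ l₀ ≠ δ l₁` for two classes `l₀ ≠ l₁`, the chain has at most `(m+1)^(K−2)` terms: the profiles of its terms
are pairwise distinct (slopes strictly increase) and each is determined by its `K − 2` coordinates off `{l₀, l₁}` (two independent
linear equations fix `n_{l₀}, n_{l₁}`).  The sign hypothesis `|ε| ≤ 1` of the census row is not needed. [folklore] -/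
theorem succ_le_pow_of_conserved (d : Fin K → ℕ) (v ε : Fin m → Fin m → Fin K → ℤ) (n : ℕ) (θ : Fin (n + 1) → ℤ)
    (p : Fin (n + 1) → Equiv.Perm (Fin m) × (Fin m → Fin K)) (hθ : StrictMono θ)
    (hdom : ∀ k, IsDominant d v ε (θ k) (p k))
    (halt : ∀ k : Fin n, termSign ε (p k.castSucc) * termSign ε (p k.succ) < 0)
    (δ : Fin K → ℤ) (Φ : ℤ) (l₀ l₁ : Fin K) (hl : l₀ ≠ l₁) (hδ : δ l₀ ≠ δ l₁)
    (hcons : ∀ k, ∑ i, δ ((p k).2 i) = Φ) :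
    n + 1 ≤ (m + 1) ^ (K - 2) := by
  classical
  -- consecutive terms are distinct (their signs multiply to a negative number)
  have hne : ∀ k : Fin n, p k.castSucc ≠ p k.succ := by
    intro k h
    have := halt k
    rw [h] at this
    exact absurd this (not_lt.mpr (mul_self_nonneg _))
  -- slopes strictly increase, hence are injective in the chain index
  have hsm : StrictMono fun k => LacunarySymmetroidMatrixDescartes.TropicalCensus.slope d (p k) := by
    rw [Fin.strictMono_iff_lt_succ]
    intro k
    exact slope_lt_of_dominant d v ε (hθ Fin.castSucc_lt_succ) (hne k) (hdom _) (hdom _)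
  -- the profile of the `k`-th term
  set cnt : Fin (n + 1) → Fin K → ℕ := fun k l => (univ.filter fun i : Fin m => (p k).2 i = l).card with hcnt
  have hcnt_le : ∀ k l, cnt k l ≤ m := by
    intro k l
    calc cnt k l ≤ (univ : Finset (Fin m)).card := Finset.card_filter_le _ _
      _ = m := by rw [Finset.card_univ, Fintype.card_fin]
  -- the two linear equations: total mass `m` and the conserved statistic `Φ`
  have hmass : ∀ k, ∑ l, (cnt k l : ℤ) = (m : ℤ) := by
    intro k
    have h := sum_comp_eq_sum_mul_card (fun _ : Fin K => (1 : ℤ)) (p k).2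
    simp only [Finset.sum_const, Finset.card_univ, Fintype.card_fin, nsmul_eq_mul, mul_one, one_mul] at h
    simp only [hcnt]
    exact h.symm
  have hstat : ∀ k, ∑ l, δ l * (cnt k l : ℤ) = Φ := by
    intro k
    simp only [hcnt]
    rw [← sum_comp_eq_sum_mul_card δ (p k).2]
    exact hcons k
  -- restricted profile: coordinates off `{l₀, l₁}`
  set S : Finset (Fin K) := (univ.erase l₀).erase l₁ with hS
  have hScard : S.card = K - 2 := by
    rw [hS, Finset.card_erase_of_mem, Finset.card_erase_of_mem (mem_univ _), Finset.card_univ, Fintype.card_fin]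
    · omega
    · exact Finset.mem_erase.mpr ⟨fun h => hl h.symm, mem_univ _⟩
  let F : Fin (n + 1) → (S → Fin (m + 1)) := fun k l => ⟨cnt k l, Nat.lt_succ_of_le (hcnt_le k l)⟩
  have hF : Function.Injective F := by
    intro k k' hkk
    -- the restricted profiles agree
    have hrest : ∀ l, l ≠ l₀ → l ≠ l₁ → cnt k l = cnt k' l := by
      intro l h0 h1
      have hlS : l ∈ S := by
        rw [hS]
        exact Finset.mem_erase.mpr ⟨h1, Finset.mem_erase.mpr ⟨h0, mem_univ _⟩⟩
      have := congrFun hkk ⟨l, hlS⟩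
      simpa [F] using congrArg Fin.val this
    -- the two remaining coordinates are fixed by the two equations
    set x : ℤ := (cnt k l₀ : ℤ) - cnt k' l₀ with hx
    set y : ℤ := (cnt k l₁ : ℤ) - cnt k' l₁ with hy
    have hzero : ∀ l, l ≠ l₀ → l ≠ l₁ → ((cnt k l : ℤ) - cnt k' l) = 0 := by
      intro l h0 h1
      rw [hrest l h0 h1, sub_self]
    have e1 : x + y = 0 := by
      have h := sub_eq_zero.mpr ((hmass k).trans (hmass k').symm)
      rw [← Finset.sum_sub_distrib] at h
      rw [sum_eq_two hl (fun l => (cnt k l : ℤ) - (cnt k' l : ℤ)) (fun l h0 h1 => hzero l h0 h1)] at h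
      rw [hx, hy]
      linarith
    have e2 : δ l₀ * x + δ l₁ * y = 0 := by
      have h := sub_eq_zero.mpr ((hstat k).trans (hstat k').symm)
      rw [← Finset.sum_sub_distrib] at h
      rw [sum_eq_two hl (fun l => δ l * (cnt k l : ℤ) - δ l * (cnt k' l : ℤ))
        (fun l h0 h1 => by rw [← mul_sub, hzero l h0 h1, mul_zero])] at h
      rw [hx, hy, mul_sub, mul_sub]
      linarith
    have hx0 : x = 0 := by
      have h3 : (δ l₀ - δ l₁) * x = 0 := by linear_combination e2 - δ l₁ * e1
      rcases mul_eq_zero.mp h3 with h | h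
      · exact absurd (sub_eq_zero.mp h) hδ
      · exact h
    have hy0 : y = 0 := by linarith
    -- hence the full profiles agree, so the slopes agree, so `k = k'`
    have hall : ∀ l, cnt k l = cnt k' l := by
      intro l
      by_cases h0 : l = l₀
      · rw [h0]
        have h := hx0
        rw [hx] at h
        exact_mod_cast sub_eq_zero.mp h
      by_cases h1 : l = l₁
      · rw [h1]
        have h := hy0
        rw [hy] at h
        exact_mod_cast sub_eq_zero.mp h
      exact hrest l h0 h1
    apply hsm.injective
    show LacunarySymmetroidMatrixDescartes.TropicalCensus.slope d (p k) =
      LacunarySymmetroidMatrixDescartes.TropicalCensus.slope d (p k')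
    rw [slope_eq_sum_mul_card, slope_eq_sum_mul_card]
    refine Finset.sum_congr rfl fun l _ => ?_
    have := hall l
    simp only [hcnt] at this
    rw [this]
  have hcard := Fintype.card_le_of_injective F hF
  rw [Fintype.card_fin, Fintype.card_fun, Fintype.card_fin, Fintype.card_coe, hScard] at hcard
  exact hcard

/-! ## 3. Cocycle-graded designs -/

/-- **COCYCLE IDENTITY.**  If class `l` is present at entry `(r, c)` only when `φR r − φC c = δ l`, then every present term
`(σ, λ)` (`termSign ≠ 0`) has `Σ_i δ(λ i) = Σ_r φR r − Σ_c φC c`. [folklore: re-indexing a sum along the permutation `σ`] -/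
theorem sum_delta_eq_of_graded (φR φC : Fin m → ℤ) (δ : Fin K → ℤ) (ε : Fin m → Fin m → Fin K → ℤ)
    (hgr : ∀ i j l, ε i j l ≠ 0 → φR i - φC j = δ l)
    (p : Equiv.Perm (Fin m) × (Fin m → Fin K)) (hp : termSign ε p ≠ 0) :
    ∑ i, δ (p.2 i) = ∑ i, φR i - ∑ i, φC i := by
  have hprod : ∏ i, ε (p.1 i) i (p.2 i) ≠ 0 := fun h => hp (by unfold termSign; rw [h, mul_zero])
  have hfac : ∀ i, ε (p.1 i) i (p.2 i) ≠ 0 := fun i h =>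
    hprod (Finset.prod_eq_zero (mem_univ i) h)
  have h1 : ∀ i, δ (p.2 i) = φR (p.1 i) - φC i := fun i => (hgr _ _ _ (hfac i)).symm
  simp_rw [h1]
  rw [Finset.sum_sub_distrib, Equiv.sum_comp p.1 φR]

/-- **GRADED CEILING.**  Every dominant sign-alternating chain of a COCYCLE-GRADED `(m, K)` design (class `l` present at `(r, c)` only
when `φR r − φC c = δ l`) whose grading separates two classes (`δ l₀ ≠ δ l₁`) has at most `(m+1)^(K−2)` terms. [folklore] -/
theorem succ_le_pow_of_graded (d : Fin K → ℕ) (v ε : Fin m → Fin m → Fin K → ℤ) (n : ℕ) (θ : Fin (n + 1) → ℤ)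
    (p : Fin (n + 1) → Equiv.Perm (Fin m) × (Fin m → Fin K)) (hθ : StrictMono θ)
    (hdom : ∀ k, IsDominant d v ε (θ k) (p k))
    (halt : ∀ k : Fin n, termSign ε (p k.castSucc) * termSign ε (p k.succ) < 0)
    (φR φC : Fin m → ℤ) (δ : Fin K → ℤ) (l₀ l₁ : Fin K) (hl : l₀ ≠ l₁) (hδ : δ l₀ ≠ δ l₁)
    (hgr : ∀ i j l, ε i j l ≠ 0 → φR i - φC j = δ l) :
    n + 1 ≤ (m + 1) ^ (K - 2) :=
  succ_le_pow_of_conserved d v ε n θ p hθ hdom halt δ (∑ i, φR i - ∑ i, φC i) l₀ l₁ hl hδ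
    (fun k => sum_delta_eq_of_graded φR φC δ ε hgr (p k) (hdom k).1)

/-- **`K = 4`: graded designs obey the `TropK4Law 2` inequality with constant `1`.**  A dominant sign-alternating chain of a
cocycle-graded `(m, 4)` design separating two classes has `n ≤ 1·(m+1)^2 − 1` breakpoints — no graded / block-band architecture can
witness a cubic `K = 4` column (`¬ TropK4Law 2`); the fork itself is untouched. [folklore] -/
theorem chain_le_sq_of_graded_four (d : Fin 4 → ℕ) (v ε : Fin m → Fin m → Fin 4 → ℤ) (n : ℕ) (θ : Fin (n + 1) → ℤ)
    (p : Fin (n + 1) → Equiv.Perm (Fin m) × (Fin m → Fin 4)) (hθ : StrictMono θ)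
    (hdom : ∀ k, IsDominant d v ε (θ k) (p k))
    (halt : ∀ k : Fin n, termSign ε (p k.castSucc) * termSign ε (p k.succ) < 0)
    (φR φC : Fin m → ℤ) (δ : Fin 4 → ℤ) (l₀ l₁ : Fin 4) (hl : l₀ ≠ l₁) (hδ : δ l₀ ≠ δ l₁)
    (hgr : ∀ i j l, ε i j l ≠ 0 → φR i - φC j = δ l) :
    n ≤ 1 * (m + 1) ^ 2 - 1 := by
  have h := succ_le_pow_of_graded d v ε n θ p hθ hdom halt φR φC δ l₀ l₁ hl hδ hgr
  rw [show (4 : ℕ) - 2 = 2 from rfl] at h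
  omega

end ProfileHyperplane

end Summit.ValiantsHypothesis.ValiantsHypothesis.Theorems.KPlusLogSqLaw
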